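import Summits.ResolutionOfSingularities.ResolutionOfSingularities.Theorems.RegularCurveLaw
import HarnessLib

/-!
# RegularCurveCut — tree file 5/6: §12 the CUT of the located residual `HypHug3Insep` (aside AGHypHug3Insep
27753) by the regular-curve law —
EXACT and hypothesis-free (the regular-curve cell DECIDED by §11; the complement is the new located residual).

Content VERBATIM from the decomp-res lens-6 g17 file
`HOME/decomp-res-lens-6/g17/parts/RegularCurveLaw-REV1-5548be76.lean` (sha256 5548be7624d15d37;
CRITIC-LEDGER row 128; critic landing order 2026-08-30T18:16:59Z).  Its §0–§8 are g16 `AbsoluteGiraud.lean`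
@bc25b587 byte-identical and ALREADY in
the tree as `Theorems/AbsoluteContact{Scope,Primitives,HasseRing,Hasse,Axes}` + `AbsoluteGiraud{Kernel,Branch}`;
only §9–§13 are landed here — §11–§13 in the text of the lens's rev 2 TREE-SYNC pin
`parts/RegularCurveLaw-REV2-fe4ab852.lean`
(code byte-identical to rev 1; five docstrings sharpened for the critic's hygiene asks h1/h2/h4, STATUS 18:31:35Z).
HOME = run/shared/lean/pub/decomp-res.  Host: route `MaxContactCut`, asides AGHypHug3Insep 27753 / AGAbsContactOff3
27752 / AGAllHug3Off3 27751
(refining 31574 `PVPureGame`).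

[WRITER NOTE (decomp-res writer g6): the critic asked for Literature/…/Resolution placement of the scheme-level
kernels §9/§10; they land
Summits-side because the Literature gate accepts only [cite:]-tagged PUBLISHED statements (same ruling as `CouplingCutCoupled` /
`AbsoluteGiraudKernel`).  ONE namespace `…Theorems.AbsoluteContactClasses` as in the lens; global `set_option`
lines dropped (scoped
`set_option maxHeartbeats … in` kept); nothing else changed.]
(Sources: Giraud1975; EncinasVillamayor2000 Thm. 4.9; BravoGarciaEscamillaVillamayor2012 Lemma 4.6;
VillamayorU2008ReesDiff §4; CossartPiltant2008 §2; CossartJannsenSaito2020 §2–§3; EGAIV4 §16–§17;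
Matsumura1986 §14–§17.)
-/

noncomputable section

open CategoryTheory AlgebraicGeometry TopologicalSpace
open Literature.AlgebraicGeometry.Resolution
open Summit.ResolutionOfSingularities.ResolutionOfSingularities.Theorems
open WeakOrderReduction ForcedTowerClasses PurityValveClasses
open SatelliteExitClasses
open IsLocalRing MvPolynomial

namespace Summit.ResolutionOfSingularities.ResolutionOfSingularities.Theorems.AbsoluteContactClasses

/-! ## §12 (g17) The CUT of the located residual `HypHug3Insep` by the regular-curve law — EXACT and hypothesis-free -/

section CurveCut

/-- **LAW · `CurveLaw3`** [KERNEL-PROVED below: `curveLaw3`; all characteristics, all fields, no purity / escaping / contact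
hypothesis] — «a CORE branch of a pure-dimension-`3`-marked datum that hugs a REGULAR CURVE GERM hugs a top
curve»: the hugged germ is
equimultiple (`𝓘 ⊆ 𝔭³` at every stage), its closure lies in `Sing₃` GLOBALLY, and `dim 𝒪/𝔭 = 1`.
The Branch-setting, regular-curve
case of lens-4's δ-descent port `HugDimensionClasses.CurveLaw`, by a different mechanism (exact `𝔭`-adic depth
of the equation drops by
`3 − c ≥ 1` at each of the infinitely many point rounds ⇒ infinite descent). Nearest printed statement: CJS
LNM 2270 p. 139–140
(«Thm. 10.2 ⇒ Thm. 6.35»: an infinite fundamental sequence forces `v_𝔮(f_i) = n_i = v_𝔪(f_i)` along the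
directrix-cut regular `V(𝔮)`,
Hilbert–Samuel stratum, `char k(x) = 0 ∨ ≥ dim X/2 + 1`); order semicontinuity as used: CJS 2009 Thm. 2.10.
(Sources: CossartJannsenSaito2020, Thm. 10.2, Thm. 6.35, p. 139-140; Kollar2007, Thm. 1.81; CossartJannsenSaito2009,
Thm. 2.10; Matsumura1987, Thm. 14.2.) -/
def CurveLaw3 : Prop :=
  ∀ (k : Type) [Field k] (B : Branch k), IsDatum 3 (B.D 0) → B.Core → B.HugsRegCurve → B.HugsTop

/-- **THEOREM (g17): the regular-curve law holds.** PROVED (§9–§11). [folklore] -/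
theorem curveLaw3 : CurveLaw3 := fun _ _ B hD hC hH => hugsTop_of_hugsRegCurve B hD hC hH

/-- **the KILLED sub-cell · `HypHug3InsepCurve`** [DECIDED TRUE in kernel: `hypHug3InsepCurve_holds`] —
`HypHug3Insep` on the branches that
hug a regular curve germ from some stage on. NONEMPTY with all hypotheses (NODE-g17.md §4: `p = 5`, `k = 𝔽₅(a)`,
`f = z̃³ + (x−1)·(y·u·z̃ + y³ + u³)`, `u = w² − x² − x³`, `z̃ = v⁵ − a`, top locus the nodal
curve `V(y,u,z̃)`; self-similar under
the point rounds, `Sing₃` of every stage = the strict transform of the nodal curve plus finitely many points; the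
nine hypotheses are
checked one by one in NODE-g17.md §4 (HOME/decomp-res-lens-6/g17/, pinned in parts/SHA256SUMS; re-walked by the
critic, CRITIC-LEDGER
row 128), incl. `τ = 3` off the node (`∂_V` of `Z³ + c(YUZ + Y³ + U³)` is `cYU ≢ 0`, so no linear change of
variables removes a
variable when `c ≠ 0`) and the rsop check via `x³ + x² − 2 = (x − 1)²(x + 3)` in `𝔽₅[x]`). -/
def HypHug3InsepCurve : Prop :=
  ∀ p : ℕ, p.Prime → p ≠ 3 → ∀ (k : Type) [Field k] [CharP k p] (B : Branch k), ¬ SepResidueAt (B.str 0) (B.pt 0) →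
    IsDatum 3 (B.D 0) → (B.D 0).boundary = [] → AllCorePure p (B.str 0) (B.base 0).isRegular (B.D 0).ideal 3 →
      B.Core → B.Pure p → B.EscapingC → B.AbsContactHypersurface → B.HugsRegCurve → B.HugsTop

/-- **the NEW LOCATED RESIDUAL · `HypHug3InsepNoCurve`** [UNDECIDED · IDEA-NEEDED · ⟺ `HypHug3Insep` hypothesis-free
(`hypHug3Insep_iff_noCurve`) · ≡ `Off3Insep` ≡ `AllHug3Off3` modulo `AbsContactOff3`] — «`p ≠ 3`, any
field, inseparable root residue: a
core, pure, C-escaping branch hugging an absolute-contact regular hypersurface germ BUT NO REGULAR CURVE GERM AT ANY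
STAGE hugs a top
curve».  The counterexample class is now: branches whose followed points leave the strict transform of EVERY
regular curve germ through
EVERY stage point — in particular (law) of every regular germ of the top locus, and of every regular curve germ on the contact
hypersurface.  IN TRUTH (not claimed in kernel, NODE-g17.md §6): a branch of this class that hugs a top curve hugs,
after finitely many
of its own point rounds (embedded resolution of the hugged curve germ), a REGULAR curve germ — so on this cell the
conclusion `HugsTop` can
only hold VACUOUSLY: the statement is a NON-EXISTENCE claim («no such branch oscillates off every regular curve
germ for ever», cf. the
sufficient re-target `HypCurve3Insep`); do not look for a positive hugging engine here.  TEST: the (V0)-family `(z^p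
− a)^3 + x·m₄` along
branches that oscillate off every regular curve (NODE-g17.md §6). -/
def HypHug3InsepNoCurve : Prop :=
  ∀ p : ℕ, p.Prime → p ≠ 3 → ∀ (k : Type) [Field k] [CharP k p] (B : Branch k), ¬ SepResidueAt (B.str 0) (B.pt 0) →
    IsDatum 3 (B.D 0) → (B.D 0).boundary = [] → AllCorePure p (B.str 0) (B.base 0).isRegular (B.D 0).ideal 3 →
      B.Core → B.Pure p → B.EscapingC → B.AbsContactHypersurface → ¬ B.HugsRegCurve → B.HugsTop

/-- **kernel (DECIDED, PROVED)**: the curve-hugging sub-cell of the residual holds — by the law, using only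
`IsDatum 3` and `Core`.
[folklore] -/
theorem hypHug3InsepCurve_holds : HypHug3InsepCurve :=
  fun _ _ _ k _ _ B _ hD _ _ hC _ _ _ hR => curveLaw3 k B hD hC hR

/-- **kernel (EXACT, PROVED)**: the residual is the conjunction of its two cells (excluded middle on
`B.HugsRegCurve`). [folklore] -/
theorem hypHug3Insep_iff_curve_and_noCurve : HypHug3Insep ↔ HypHug3InsepCurve ∧ HypHug3InsepNoCurve := by
  constructor
  · intro h
    exact ⟨fun p hp hp3 k _ _ B hs hD hb hAc hC hPu hE hAbs _ => h p hp hp3 k B hs hD hb hAc hC hPu hE hAbs,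
      fun p hp hp3 k _ _ B hs hD hb hAc hC hPu hE hAbs _ => h p hp hp3 k B hs hD hb hAc hC hPu hE hAbs⟩
  · rintro ⟨hc, hn⟩ p hp hp3 k _ _ B hs hD hb hAc hC hPu hE hAbs
    by_cases hR : B.HugsRegCurve
    · exact hc p hp hp3 k B hs hD hb hAc hC hPu hE hAbs hR
    · exact hn p hp hp3 k B hs hD hb hAc hC hPu hE hAbs hR

/-- **kernel (EXACT and HYPOTHESIS-FREE, PROVED)**: the booked residual `HypHug3Insep` IS the no-regular-curve
residual. [folklore] -/
theorem hypHug3Insep_iff_noCurve : HypHug3Insep ↔ HypHug3InsepNoCurve :=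
  ⟨fun h => (hypHug3Insep_iff_curve_and_noCurve.1 h).2,
    fun h => hypHug3Insep_iff_curve_and_noCurve.2 ⟨hypHug3InsepCurve_holds, h⟩⟩

/-- **`closes17`** (g17: TWO inputs, the second strictly re-located) — the `p ≠ 3` aside `AllHug3Off3` from the
new lemma `AbsContactOff3`
(g15/g16) and the no-regular-curve residual. PROVED. [folklore] -/
theorem closes17 (hA : AbsContactOff3) (hN : HypHug3InsepNoCurve) : AllHug3Off3 :=
  closes hA (hypHug3Insep_iff_noCurve.2 hN)

/-- **`closes17_imp`** — g14's seam piece `AllHug3Off3Imp` from the same two inputs. PROVED. [folklore] -/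
theorem closes17_imp (hA : AbsContactOff3) (hN : HypHug3InsepNoCurve) : AllHug3Off3Imp :=
  allHug3Off3_iff_imp.1 (closes17 hA hN)

/-- **kernel (EXACT mod the new lemma, PROVED)**: given `AbsContactOff3`, the no-curve residual IS g15's residue
slice `Off3Insep`.
[folklore] -/
theorem off3Insep_iff_noCurve (hA : AbsContactOff3) : Off3Insep ↔ HypHug3InsepNoCurve :=
  (off3Insep_iff_hypHug3Insep hA).trans hypHug3Insep_iff_noCurve

/-- **kernel (EXACT mod the new lemma, PROVED)**: given `AbsContactOff3`, the no-curve residual IS the whole aside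
`AllHug3Off3`.
[folklore] -/
theorem allHug3Off3_iff_noCurve (hA : AbsContactOff3) : AllHug3Off3 ↔ HypHug3InsepNoCurve :=
  (allHug3Off3_iff_hypHug3Insep hA).trans hypHug3Insep_iff_noCurve

/-- **kernel (EXACT mod the new lemma, PROVED)**: … and IS g14's imperfect-field seam `AllHug3Off3Imp`. [folklore] -/
theorem allHug3Off3Imp_iff_noCurve (hA : AbsContactOff3) : AllHug3Off3Imp ↔ HypHug3InsepNoCurve :=
  (allHug3Off3Imp_iff_hypHug3Insep hA).trans hypHug3Insep_iff_noCurve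

/-- sanity (PROVED): the target gives back both cells of the g17 cut. [folklore] -/
theorem cells_of_allHug3Off3 (h : AllHug3Off3) : HypHug3InsepCurve ∧ HypHug3InsepNoCurve :=
  hypHug3Insep_iff_curve_and_noCurve.1 (pieces_of_allHug3Off3 h).2.2.1

/-- **SUFFICIENT re-target · `HypCurve3Insep`** [UNDECIDED · implies the residual
(`hypHug3Insep_of_hypCurve3Insep`); equivalent to it in
truth via embedded resolution of the hugged top curve, NOT claimed in kernel] — «… such a branch hugs SOME
regular curve germ from some
stage on».  The form in which CJS-type termination arguments actually conclude (the fundamental sequence of a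
curve-hugging branch is
eventually a sequence of point blow-ups of a regular curve). (Sources: CossartJannsenSaito2009, §5.) -/
def HypCurve3Insep : Prop :=
  ∀ p : ℕ, p.Prime → p ≠ 3 → ∀ (k : Type) [Field k] [CharP k p] (B : Branch k), ¬ SepResidueAt (B.str 0) (B.pt 0) →
    IsDatum 3 (B.D 0) → (B.D 0).boundary = [] → AllCorePure p (B.str 0) (B.base 0).isRegular (B.D 0).ideal 3 →
      B.Core → B.Pure p → B.EscapingC → B.AbsContactHypersurface → B.HugsRegCurve

/-- **kernel (PROVED)**: the sufficient re-target gives the residual (through the law). [folklore] -/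
theorem hypHug3Insep_of_hypCurve3Insep (h : HypCurve3Insep) : HypHug3Insep :=
  fun p hp hp3 k _ _ B hs hD hb hAc hC hPu hE hAbs => curveLaw3 k B hD hC (h p hp hp3 k B hs hD hb hAc hC hPu hE hAbs)

/-- **kernel (PROVED)**: … hence the no-curve residual (vacuously on its own cell). [folklore] -/
theorem noCurve_of_hypCurve3Insep (h : HypCurve3Insep) : HypHug3InsepNoCurve :=
  hypHug3Insep_iff_noCurve.1 (hypHug3Insep_of_hypCurve3Insep h)

/-- **`closes17'`** — the aside from `AbsContactOff3` and the sufficient re-target. PROVED. [folklore] -/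
theorem closes17' (hA : AbsContactOff3) (hC : HypCurve3Insep) : AllHug3Off3 :=
  closes hA (hypHug3Insep_of_hypCurve3Insep hC)

end CurveCut

end Summit.ResolutionOfSingularities.ResolutionOfSingularities.Theorems.AbsoluteContactClasses
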